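import Literature.Analysis.FluidPDE.NSLerayHopfSereginEnergyProofs
import Literature.Analysis.FluidPDE.KatoFarFieldBound
import Literature.Analysis.FluidPDE.MildL3SmoothHolds
import HarnessLib

/-!
# Seregin's `L³` blow-up criterion: the three tree statements from the one remaining fact

Analysis/FluidPDE glue file (theorems only; no definitions, no named facts, no `sorry`).
Seregin 2012 (Comm. Math. Phys. 312, 833–845 = arXiv:1104.3615), Thm. 1.1: if `T` is a finite
blow-up time of an energy solution `v` from `a ∈ C^∞_{0,0}(ℝ³)`, then `‖v(t)‖₃ → ∞` as `t ↑ T`.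
The tree carries the theorem in three renderings —

* `seregin_L3_blowup_energy` (`NSLerayHopfSereginProofs.lean`): the printed energy-solution form;
* `seregin_L3_blowup_mild` (`NSLerayHopfSereginMild.lean`): Lemarié-Rieusset 2016, Thm. 15.5, the
  mild `C_t L³` form;
* `seregin_L3_blowup` (`NSLerayHopf.lean`, ns.S08): the maximal-smooth form —

and accepted reductions of each to the pair of named facts
`lemarieRieusset_singular_point_of_blowup` (Lemarié-Rieusset 2016, Thm. 15.1 (C): a finite
maximal time of the Kato solution carries a singular point `(T, x₀)`) and
`seregin_regular_of_liminf_L3` (the core of Seregin's proof, §§2–4 = Lemarié-Rieusset 2016,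
proof of Thm. 15.5, PDF pp. 570–573: an `L³` bound along `t_k ↑ T` makes every `(T, x₀)`
regular): `seregin_L3_blowup_energy_of_leaves` (`NSLerayHopfSereginEnergyProofs.lean`),
`seregin_L3_blowup_mild_of_singular_point` (`NSLerayHopfSereginMild.lean`), and
`seregin_L3_blowup_of_seregin_mild` (`MildL3SmoothHolds.lean`, with `mild_L3_smooth_holds`).

The first fact is now a theorem of the tree: `lemarieRieusset_singular_point_of_blowup_holds`
(`KatoFarFieldBound.lean`, from `kato_local_bounded_holds` and the far-field bound
`IsKatoSolutionOn.farField_bound_holds`). This file records the consequence: all three statements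
follow from the SINGLE named fact `seregin_regular_of_liminf_L3`, so that each discharge is the
corresponding theorem below applied to `seregin_regular_of_liminf_L3_holds` once it lands (its
accepted reductions: `seregin_regular_of_liminf_L3_of_profile`, `_of_leaves`, `_of_leray_theory`,
`_of_farField`, `_of_localLeray`, `_of_slab_facts`, `_of_slab_layer2`, `_of_slab_layer3`,
`_of_slab_leaves`). Pure compositions of accepted reductions with accepted discharges; no
statement is changed.

## References

* G. Seregin, *A certain necessary condition of potential blow up for Navier–Stokes equations*,
  Comm. Math. Phys. 312 (2012), 833–845 = arXiv:1104.3615: Thm. 1.1, §2 (first paragraph).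
  [Seregin2012CMP]
* P. G. Lemarié-Rieusset, *The Navier–Stokes Problem in the 21st Century*, CRC Press 2016:
  Thm. 15.1 (C) (PDF pp. 565–566), Thm. 15.5 (proof, PDF pp. 570–573), Thm. 15.13.
  [LemarieRieusset2016]
-/

noncomputable section

namespace Literature.Analysis.FluidPDE

/-- **Seregin 2012, Thm. 1.1 (energy-solution form) from the core fact alone**:
`seregin_L3_blowup_energy_of_leaves` with Thm. 15.1 (C) discharged
(`lemarieRieusset_singular_point_of_blowup_holds`). The discharge `seregin_L3_blowup_energy_holds`
is this theorem applied to `seregin_regular_of_liminf_L3_holds`.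
[cite: Seregin2012CMP, Thm. 1.1 and §2] [cite: LemarieRieusset2016, Thm. 15.1 (C), Thm. 15.5 (proof, pp. 570–573)] -/
theorem seregin_L3_blowup_energy_of_liminf_L3 (h : seregin_regular_of_liminf_L3) :
    seregin_L3_blowup_energy :=
  seregin_L3_blowup_energy_of_leaves lemarieRieusset_singular_point_of_blowup_holds h

/-- **Lemarié-Rieusset 2016, Thm. 15.5 (mild form of Seregin's theorem) from the core fact
alone**: `seregin_L3_blowup_mild_of_singular_point` with Thm. 15.1 (C) discharged.
[cite: LemarieRieusset2016, Thm. 15.5 and its proof, pp. 570–573] [cite: Seregin2012CMP, Thm. 1.1] -/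
theorem seregin_L3_blowup_mild_of_liminf_L3 (h : seregin_regular_of_liminf_L3) :
    seregin_L3_blowup_mild :=
  seregin_L3_blowup_mild_of_singular_point lemarieRieusset_singular_point_of_blowup_holds h

/-- **Seregin 2012, Thm. 1.1 in the tree's maximal-smooth form (ns.S08 `seregin_L3_blowup`) from
the core fact alone**: `seregin_L3_blowup_of_seregin_mild` (Thm. 15.13 with Thm. 15.1 (A)
discharged, `mild_L3_smooth_holds`) composed with `seregin_L3_blowup_mild_of_liminf_L3`.
[cite: Seregin2012CMP, Thm. 1.1] [cite: LemarieRieusset2016, Thm. 15.13 with Thm. 15.5, Thm. 15.1 (A), (C)] -/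
theorem seregin_L3_blowup_of_liminf_L3 (h : seregin_regular_of_liminf_L3) : seregin_L3_blowup :=
  seregin_L3_blowup_of_seregin_mild (seregin_L3_blowup_mild_of_liminf_L3 h)

end Literature.Analysis.FluidPDE

end
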